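import Literature.NumberTheory.EllipticCurves.ZpExtensionDescentProofs
import Literature.NumberTheory.EllipticCurves.IwasawaSelmerProofs
import HarnessLib

/-!
# Crux `PrintCf2.SplitBadTwoRankOneOfFacts` (stmt-BirchSwinnertonDyer-20368), S3a-quad brick (e2): INFLATION–RESTRICTION ALONG A
# FINITE CYCLIC QUOTIENT, I — the lift of an invariant class of `H¹(H′, M)` to `H¹(H, M)` when the `Ĥ⁰`-obstruction is a norm
# (generic: any topological group, any discrete module)

Cell `bsd-print-cf2`, width seat `bsd-line-cf2-p1-w5` g6 («width 5»), `--supports stmt-BirchSwinnertonDyer-20368 --as helper`, Theses-free.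
HONEST FRAMING: nothing here closes the crux or a registered stub; no summit statement is proved by this seat; BSD is not proved by any of this.
No definition, no named fact, no `sorry`.

WHY. The DECIDING stub S3a-quad (`stub_twoVariableMC_two_quad`, route-C twin 24033) is assembled by cf2c-w6 g2's socket
`ClassGroupQuotient.map_charIdeal_dual_eq_span_of_…` from a CFT four-term sequence over `𝔎_∞ = K̃_∞·K_θ` and COMPARISON maps with finite
defects (memo `Cruxes/TwoVariableMainConjAtSplitTwo/BRICK-D-FOURTERM-PART2-w6g2.md` §4bis); the X-side comparison is the transpose of the
restriction `res : H¹_nr(K̃_∞, A_θ) → H¹_nr(𝔎_∞, A_θ)^{Δ′}`, `Δ′ = Gal(𝔎_∞/K̃_∞)` cyclic of order `≤ 2`, and what the socket consumes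
(`DualTranspose.finite_ker_transpose_of_finite_quotient_range` / `finite_quotient_range_transpose_of_finite_ker`, p690891) is exactly
`Finite (ker res)` and `Finite (invariants ⧸ range res)`. This file (I) and its sequel (II, `…CyclicInfResFinite`) are the GROUP-COHOMOLOGY
core of both, for an arbitrary topological group `G`, subgroups `H′ ≤ H ≤ G` with `H′` normal in `G` and relatively open in `H`, and `γ ∈ H`
generating the finite cyclic quotient `H/H′` (order `t`: `γᵗ ∈ H′`, `γᵈ ∈ H′ ⟹ t ∣ d`, `H = ⋃_{k<t} γᵏ H′`), coefficients any discrete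
`G`-module `M`:

* §1 `exists_witness_of_conjH1_eq` — `conj_γ [φ] = [φ]` in `H¹(H′, M)` is witnessed by `m ∈ M`: `γ·φ(γ⁻¹nγ) − φ(n) = n·m − m`;
  `smul_obstruction_eq` / `smul_obstruction_eq'` — the OBSTRUCTION `ob := φ(γᵗ) − Σ_{i<t} γⁱ·m` is `H′`-fixed and `γ`-fixed
  (it is the transgression class in `Ĥ⁰(⟨γ⟩, M^{H′}) = H²(H/H′, M^{H′})`);
* §2 **`exists_resOfLe_eq_of_witness`** — if `φ(γᵗ) = Σ_{i<t} γⁱ·m` (obstruction zero) then `[φ] = res y` for some `y ∈ H¹(H, M)`: the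
  tree's algebraic extension `ZpDescent.ext` (`ĉ(γᵏn) = s_k + γᵏ·c(n)`, `ExtData` with `U = ⊥`) is a CONTINUOUS cocycle on `H` (locally
  constant: `H′` is relatively open and `φ` vanishes near `1`) restricting to `φ`;
  **`exists_resOfLe_eq_of_conjH1_eq_of_norm`** — if every `H′`-fixed `γ`-fixed `a ∈ M` is a norm `Σ_{i<t} γⁱ·b` of an `H′`-fixed `b`
  (`Ĥ⁰ = 0`), EVERY `γ`-invariant class of `H¹(H′, M)` is a restriction.

Nearest tree results (cited, not duplicated): `ZpDescent.exists_resSubgroup_eq_of_conjH1_eq` (PROCYCLIC quotient, `H² = 0`),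
`AlignedTransportAtTwoFineRoad.InfResSurj.exists_resOfLe_eq_of_forall_conjH1_eq` (finite quotient with `M^{H′} = 0`),
`Literature…H1CorestrictionIndexTwo` (index-`2` corestriction, `cor ∘ res = 2`). Here `M^{H′} ≠ 0` is allowed and the obstruction is
DISPLAYED — the case of `A_θ` over `𝔎_∞`, on which `H′` acts trivially.

presearch: inflation–restriction–transgression for a finite cyclic quotient → [corpus: NSW *Cohomology of Number Fields* I §6 Prop. 1.6.7]
(cited in `Literature/AnabelianGeometry/EtaleTheta/ContH1CyclicExtensionFinite.lean`, multiplicative `ContH1` model, not importable here);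
Serre *Galois Cohomology* I §2.6 (b); Greenberg LNM 1716 §3 Lemmas 3.1–3.2. beyond-print theorem: no.

References: [SerreGaloisCohomology1997] I.§2.6 (b); [NeukirchSchmidtWingberg2008] I.§6 Prop. 1.6.7; [GreenbergLNM1716] §3 Lemmas 3.1–3.2.
-/

noncomputable section

open scoped Classical

set_option linter.dupNamespace false -- D-0017: `…BirchSwinnertonDyer.BirchSwinnertonDyer…` repeats a namespace by design
set_option autoImplicit false

open Literature.NumberTheory.EllipticCurves
open Literature.NumberTheory.EllipticCurves.ResKernel
open Literature.NumberTheory.EllipticCurves.ZpDescent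
open Literature.NumberTheory.GaloisRepresentations

universe u

namespace Summit.BirchSwinnertonDyer.BirchSwinnertonDyer.Theorems.PrintCf2.CyclicInfRes

variable {G : Type u} [Group G] [TopologicalSpace G] [IsTopologicalGroup G]
  {H' H : Subgroup G}
  {M : Type u} [AddCommGroup M] [DistribMulAction G M] [TopologicalSpace M] [DiscreteTopology M]

/-! ## §0. Restriction and conjugation on explicit cocycles -/

/-- `res_{H′ ≤ H} [Φ] = [Φ ∘ incl]` on explicit cocycles (`map_oneCocycleClass`). [cite: SerreGaloisCohomology1997, I.§2.4] -/
theorem resOfLe_oneCocycleClass (hle : H' ≤ H) (Φ : contOneCocycles (discreteTopRep H M)) :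
    resOfLe M hle (oneCocycleClass _ Φ) =
      oneCocycleClass _ (contOneCocycles.pullback (subgroupInclusion hle)
        (resHomOfEquivariant (subgroupInclusion hle) (AddMonoidHom.id M) (fun _ _ ↦ rfl)) Φ) :=
  map_oneCocycleClass _ _ _ Φ

/-- `conj_γ [φ] = [n ↦ γ·φ(γ⁻¹nγ)]` on explicit cocycles of the normal subgroup `H′` (`map_oneCocycleClass`).
[cite: SerreGaloisCohomology1997, I.§2.5] -/
theorem conjH1_oneCocycleClass [H'.Normal] (γ : G) (φ : contOneCocycles (discreteTopRep H' M)) :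
    conjH1 H' M γ (oneCocycleClass _ φ) =
      oneCocycleClass _ (contOneCocycles.pullback (subgroupConj H' γ)
        (resHomOfEquivariant (subgroupConj H' γ) (DistribSMul.toAddMonoidHom M γ) (fun x m ↦ by
          simp only [DistribSMul.toAddMonoidHom_apply, Subgroup.smul_def, subgroupConj_apply_coe,
            smul_smul, mul_assoc, mul_inv_cancel_left])) φ) :=
  map_oneCocycleClass _ _ _ φ

/-! ## §1. The witness of invariance and the obstruction -/

/-- **The witness of `γ`-invariance.** If `conj_γ [φ] = [φ]` in `H¹(H′, M)` then for some `m ∈ M`: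
`γ·φ(γ⁻¹ n γ) − φ(n) = n·m − m` for all `n ∈ H′` (the difference of the two cocycles is the coboundary of `m`).
[cite: SerreGaloisCohomology1997, I.§2.6 (b)] -/
theorem exists_witness_of_conjH1_eq [H'.Normal] (γ : G) (φ : contOneCocycles (discreteTopRep H' M))
    (hx : conjH1 H' M γ (oneCocycleClass _ φ) = oneCocycleClass _ φ) :
    ∃ m : M, ∀ n : H', γ • φ.1 (subgroupConj H' γ n) - φ.1 n = (n : G) • m - m := by
  rw [conjH1_oneCocycleClass, ← sub_eq_zero, ← oneCocycleClass_sub, oneCocycleClass_eq_zero_iff] at hx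
  obtain ⟨m, hm⟩ := hx
  refine ⟨m, fun n ↦ ?_⟩
  have := hm n
  rw [Submodule.coe_sub, ContinuousMap.sub_apply, contOneCocycles.pullback_apply] at this
  exact this

/-- `Σ_{i<l} γⁱ·(a + b) = Σ_{i<l} γⁱ·a + Σ_{i<l} γⁱ·b`. [folklore] -/
theorem sum_range_smul_add {G₀ : Type*} [Group G₀] {M₀ : Type*} [AddCommGroup M₀] [DistribMulAction G₀ M₀]
    (γ : G₀) (a b : M₀) (l : ℕ) :
    ∑ i ∈ Finset.range l, γ ^ i • (a + b) = ∑ i ∈ Finset.range l, γ ^ i • a + ∑ i ∈ Finset.range l, γ ^ i • b := by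
  simp only [smul_add, Finset.sum_add_distrib]

/-- `Σ_{i<l} γⁱ·(a − b) = Σ_{i<l} γⁱ·a − Σ_{i<l} γⁱ·b`. [folklore] -/
theorem sum_range_smul_sub {G₀ : Type*} [Group G₀] {M₀ : Type*} [AddCommGroup M₀] [DistribMulAction G₀ M₀]
    (γ : G₀) (a b : M₀) (l : ℕ) :
    ∑ i ∈ Finset.range l, γ ^ i • (a - b) = ∑ i ∈ Finset.range l, γ ^ i • a - ∑ i ∈ Finset.range l, γ ^ i • b := by
  simp only [smul_sub, Finset.sum_sub_distrib]

/-- `γ · Σ_{i<l} γⁱ·m = Σ_{i<l} γⁱ·m + γˡ·m − m` (telescoping). [folklore] -/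
theorem smul_sum_range_smul {G₀ : Type*} [Group G₀] {M₀ : Type*} [AddCommGroup M₀] [DistribMulAction G₀ M₀]
    (γ : G₀) (m : M₀) (l : ℕ) :
    γ • ∑ i ∈ Finset.range l, γ ^ i • m = ∑ i ∈ Finset.range l, γ ^ i • m + γ ^ l • m - m := by
  have h1 := sPow_succ γ m l
  rw [sPow_succ_right] at h1
  -- `h1 : s_l + γ^l m = m + γ • s_l`
  unfold sPow at h1
  rw [eq_sub_iff_add_eq, add_comm _ m, ← h1]

/-- **The obstruction is `H′`-fixed.** With the witness `m` of §1, `ob := φ(γᵗ) − Σ_{i<t} γⁱ·m` (`γᵗ ∈ H′`) satisfies `n·ob = ob` for every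
`n ∈ H′`: compare `γᵗ ⋆ φ = φ + ∂(Σ_{i<t} γⁱ m)` (iterating the witness identity) with `γᵗ ⋆ φ = φ + ∂ φ(γᵗ)` (inner conjugation by
`γᵗ ∈ H′`). [cite: NeukirchSchmidtWingberg2008, I.§6 Prop. 1.6.7] -/
theorem smul_obstruction_eq [H'.Normal] {γ : G} {t : ℕ} (hγt : γ ^ t ∈ H') (φ : contOneCocycles (discreteTopRep H' M))
    (m : M) (hstar : ∀ n : H', γ • φ.1 (subgroupConj H' γ n) - φ.1 n = (n : G) • m - m) (n : H') :
    (n : G) • (φ.1 ⟨γ ^ t, hγt⟩ - ∑ i ∈ Finset.range t, γ ^ i • m) =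
      φ.1 ⟨γ ^ t, hγt⟩ - ∑ i ∈ Finset.range t, γ ^ i • m := by
  -- the cocycle as a function on `G`
  let c : G → M := fun g ↦ if hg : g ∈ H' then φ.1 ⟨g, hg⟩ else 0
  have hcN : ∀ (g) (hg : g ∈ H'), c g = φ.1 ⟨g, hg⟩ := fun g hg ↦ dif_pos hg
  have hc : IsCocycleOn H' c := by
    intro h hh h' hh'
    rw [hcN _ (H'.mul_mem hh hh'), hcN _ hh, hcN _ hh']
    exact φ.2 ⟨h, hh⟩ ⟨h', hh'⟩
  have hstar' : ∀ h ∈ H', conjTwist γ c h = c h + cob m h := by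
    intro h hh
    have := hstar ⟨h, hh⟩
    rw [conjTwist_apply, cob_apply, hcN _ hh,
      hcN _ (by simpa using Subgroup.Normal.conj_mem inferInstance h hh γ⁻¹)]
    rw [sub_eq_iff_eq_add'] at this
    exact this
  -- `γ^t ⋆ c = c + ∂ s_t` and `γ^t ⋆ c = c + ∂ (c γ^t)`
  have k1 := conjTwist_pow (N := H') γ m hstar' t n n.2
  have k2 : conjTwist (γ ^ t) c n = c n + cob (c (γ ^ t)) n := hc.conjTwist_of_mem hγt n n.2
  rw [k2, add_right_inj, cob_apply, cob_apply, hcN _ hγt] at k1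
  rw [smul_sub]
  show (n : G) • φ.1 ⟨γ ^ t, hγt⟩ - (n : G) • sPow γ m t = φ.1 ⟨γ ^ t, hγt⟩ - sPow γ m t
  exact sub_eq_sub_iff_sub_eq_sub.mpr k1

/-- **The obstruction is `γ`-fixed**: `γ·ob = ob` (the witness identity at `n = γᵗ`, which commutes with `γ`, and the telescoping
`γ·Σ_{i<t} γⁱ m = Σ_{i<t} γⁱ m + γᵗ m − m`). So `ob` lies in `(M^{H′})^γ`, and its class modulo the norms `Σ_{i<t} γⁱ·(M^{H′})` is the
transgression of `[φ]` in `Ĥ⁰(⟨γ⟩, M^{H′}) ≅ H²(H/H′, M^{H′})`. [cite: NeukirchSchmidtWingberg2008, I.§6 Prop. 1.6.7] -/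
theorem smul_obstruction_eq' [H'.Normal] {γ : G} {t : ℕ} (hγt : γ ^ t ∈ H') (φ : contOneCocycles (discreteTopRep H' M))
    (m : M) (hstar : ∀ n : H', γ • φ.1 (subgroupConj H' γ n) - φ.1 n = (n : G) • m - m) :
    γ • (φ.1 ⟨γ ^ t, hγt⟩ - ∑ i ∈ Finset.range t, γ ^ i • m) = φ.1 ⟨γ ^ t, hγt⟩ - ∑ i ∈ Finset.range t, γ ^ i • m := by
  have h := hstar ⟨γ ^ t, hγt⟩
  have hconj : subgroupConj H' γ ⟨γ ^ t, hγt⟩ = ⟨γ ^ t, hγt⟩ := Subtype.ext (by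
    rw [subgroupConj_apply_coe]; group)
  rw [hconj] at h
  -- `h : γ • φ(γ^t) - φ(γ^t) = γ^t • m - m`
  rw [smul_sub, smul_sum_range_smul]
  have h' : γ • φ.1 ⟨γ ^ t, hγt⟩ = φ.1 ⟨γ ^ t, hγt⟩ + (γ ^ t • m - m) := by
    rw [← h]; abel
  rw [h']
  abel

/-! ## §2. The lift: an invariant class whose obstruction is a norm is a restriction -/

omit [IsTopologicalGroup G] [DistribMulAction G M] [DiscreteTopology M] in
/-- `(H ⊓ K′).subgroupOf H` is open in `H` when `K′` is open in `G` (preimage of `K′` under the inclusion). [folklore] -/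
theorem isOpen_subgroupOf_inf {K' : Subgroup G} (hK' : IsOpen (K' : Set G)) :
    IsOpen (((H ⊓ K').subgroupOf H : Subgroup H) : Set H) := by
  have e : (((H ⊓ K').subgroupOf H : Subgroup H) : Set H) = Subtype.val ⁻¹' (K' : Set G) := by
    ext x
    simp only [SetLike.mem_coe, Subgroup.mem_subgroupOf, Subgroup.mem_inf, Set.mem_preimage]
    exact ⟨fun h ↦ h.2, fun h ↦ ⟨x.2, h⟩⟩
  rw [e]
  exact hK'.preimage continuous_subtype_val

omit [IsTopologicalGroup G] [DistribMulAction G M] [DiscreteTopology M] in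
/-- `H′.subgroupOf H` is open in `H` when `H′ = H ⊓ K′` with `K′` open in `G`. [folklore] -/
theorem isOpen_subgroupOf_of_eq_inf {K' : Subgroup G} (hK' : IsOpen (K' : Set G)) (hH' : H' = H ⊓ K') :
    IsOpen ((H'.subgroupOf H : Subgroup H) : Set H) := by
  subst hH'
  exact isOpen_subgroupOf_inf hK'

/-- **THE LIFT.** Let `H′ ≤ H ≤ G` with `H′` normal in `G` and relatively open in `H`, `γ ∈ H`, `t > 0` with `γᵗ ∈ H′`,
`γᵈ ∈ H′ ⟹ t ∣ d` and `H = ⋃_{k<t} γᵏ H′` (so `H/H′` is cyclic of order `t` generated by `γ`); `M` any discrete `G`-module.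
If a continuous cocycle `φ` of `H′` has a witness `m` of `γ`-invariance (§1) for which the obstruction VANISHES,
`φ(γᵗ) = Σ_{i<t} γⁱ·m`, then `[φ] = res_{H′ ≤ H} y` for some `y ∈ H¹(H, M)`: `y = [ĉ]` with `ĉ(γᵏ n) = Σ_{i<k} γⁱ·m + γᵏ·φ(n)` the tree's
`ZpDescent.ext` (cocycle identity `ZpDescent.ext_mul`), which is locally constant on `H` because `H′` is relatively open and `φ` vanishes on a
neighbourhood of `1`. [cite: SerreGaloisCohomology1997, I.§2.6 (b)] [cite: NeukirchSchmidtWingberg2008, I.§6 Prop. 1.6.7] -/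
theorem exists_resOfLe_eq_of_witness [H'.Normal] (hle : H' ≤ H) {γ : G} (hγ : γ ∈ H) {t : ℕ} (ht : 0 < t)
    (hγt : γ ^ t ∈ H') (hdvd : ∀ d : ℕ, γ ^ d ∈ H' → t ∣ d) (hcover : ∀ g ∈ H, ∃ k < t, ∃ n ∈ H', g = γ ^ k * n)
    (hopen : IsOpen ((H'.subgroupOf H : Subgroup H) : Set H))
    (φ : contOneCocycles (discreteTopRep H' M)) (m : M)
    (hstar : ∀ n : H', γ • φ.1 (subgroupConj H' γ n) - φ.1 n = (n : G) • m - m)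
    (hkey : φ.1 ⟨γ ^ t, hγt⟩ = ∑ i ∈ Finset.range t, γ ^ i • m) :
    ∃ y : subgroupH1 H M, resOfLe M hle y = oneCocycleClass _ φ := by
  -- work in the topological group `Hs := ↥H` with `N := H′.subgroupOf H`, `γs := ⟨γ, hγ⟩`
  let N : Subgroup H := H'.subgroupOf H
  haveI : N.Normal := inferInstance
  let γs : H := ⟨γ, hγ⟩
  -- the cocycle as a function on `↥H`
  let c : H → M := fun h ↦ if hh : (h : G) ∈ H' then φ.1 ⟨h, hh⟩ else 0
  have hcN : ∀ (h : H) (hh : (h : G) ∈ H'), c h = φ.1 ⟨h, hh⟩ := fun h hh ↦ dif_pos hh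
  have hc : IsCocycleOn N c := by
    intro h hh h' hh'
    rw [Subgroup.mem_subgroupOf] at hh hh'
    rw [hcN _ (by rw [Subgroup.coe_mul]; exact H'.mul_mem hh hh'), hcN _ hh, hcN _ hh']
    exact φ.2 ⟨h, hh⟩ ⟨h', hh'⟩
  have hstar' : ∀ h ∈ N, conjTwist γs c h = c h + cob m h := by
    intro h hh
    rw [Subgroup.mem_subgroupOf] at hh
    have := hstar ⟨h, hh⟩
    have hconj : ((γs⁻¹ * h * γs : H) : G) ∈ H' := by
      simpa using Subgroup.Normal.conj_mem inferInstance (h : G) hh γ⁻¹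
    rw [conjTwist_apply, cob_apply, hcN _ hh, hcN _ hconj]
    rw [sub_eq_iff_eq_add'] at this
    exact this
  -- `U = ⊥`
  have hUM : ∀ u ∈ (⊥ : Subgroup H), ∀ v : M, u • v = v := by
    intro u hu v
    rw [Subgroup.mem_bot] at hu
    rw [hu, one_smul]
  have hUc : ∀ x ∈ N, x ∈ (⊥ : Subgroup H) → c x = 0 := by
    intro x _ hx
    rw [Subgroup.mem_bot] at hx
    rw [hx]
    exact hc.map_one
  -- `sPow γs m l = Σ γ^i • m`
  have hsPow : ∀ (m' : M) (l : ℕ), sPow γs m' l = ∑ i ∈ Finset.range l, γ ^ i • m' := fun m' l ↦ rfl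
  have hγst : γs ^ t ∈ N := by
    rw [Subgroup.mem_subgroupOf, Subgroup.coe_pow]; exact hγt
  -- the extension data (obstruction zero)
  let D : ExtData N (⊥ : Subgroup H) γs m c :=
    { t := t
      t_pos := ht
      nt := γs ^ t
      ut := 1
      nt_mem := hγst
      ut_mem := Subgroup.one_mem _
      pow_t := (mul_one _).symm
      key := by rw [hcN _ (by rw [Subgroup.coe_pow]; exact hγt), hsPow]; exact hkey
      dvd_of_mem := fun d n u hn hu e ↦ by
        rw [Subgroup.mem_bot] at hu
        rw [hu, mul_one] at e
        refine hdvd d ?_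
        have : ((γs ^ d : H) : G) ∈ H' := by rw [e]; exact Subgroup.mem_subgroupOf.mp hn
        rwa [Subgroup.coe_pow] at this
      cover := fun g ↦ by
        obtain ⟨k, hk, n, hn, hg⟩ := hcover g g.2
        refine ⟨k, hk, ⟨n, ?_⟩, ?_, 1, Subgroup.one_mem _, ?_⟩
        · have : n = (γ ^ k)⁻¹ * g := by rw [hg]; group
          rw [this]
          exact H.mul_mem (H.inv_mem (H.pow_mem hγ k)) g.2
        · rw [Subgroup.mem_subgroupOf]; exact hn
        · apply Subtype.ext
          simp only [Subgroup.coe_mul, Subgroup.coe_pow, mul_one]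
          exact hg }
  -- continuity: `ĉ` is locally constant (`φ` vanishes near `1`, `N` is open in `H`)
  have hzero : IsOpen {n : H' | φ.1 n = 0} := (isOpen_discrete ({0} : Set M)).preimage φ.1.continuous
  -- transport the zero set to `↥N ⊆ ↥H`
  let j : N → H' := fun x ↦ ⟨((x : H) : G), Subgroup.mem_subgroupOf.mp x.2⟩
  have hj : Continuous j := (continuous_subtype_val.comp continuous_subtype_val).subtype_mk _
  have hVopen : IsOpen ((Subtype.val : N → H) '' (j ⁻¹' {n : H' | φ.1 n = 0})) :=
    hopen.isOpenMap_subtype_val _ (hzero.preimage hj)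
  set V : Set H := (Subtype.val : N → H) '' (j ⁻¹' {n : H' | φ.1 n = 0}) with hVdef
  have h1V : (1 : H) ∈ V := ⟨⟨1, N.one_mem⟩, by
    show φ.1 (j ⟨1, N.one_mem⟩) = 0
    have : j ⟨1, N.one_mem⟩ = 1 := Subtype.ext rfl
    rw [this]; exact contOneCocycles.apply_one φ, rfl⟩
  have hVN : ∀ w ∈ V, w ∈ N ∧ c w = 0 := by
    rintro w ⟨x, hx, rfl⟩
    refine ⟨x.2, ?_⟩
    rw [hcN _ (Subgroup.mem_subgroupOf.mp x.2)]
    exact hx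
  have hcontext : Continuous (ext D) := by
    refine IsLocallyConstant.continuous ((IsLocallyConstant.iff_eventually_eq _).mpr fun g ↦ ?_)
    have hVg : IsOpen ((fun g' : H ↦ g⁻¹ * g') ⁻¹' V) := hVopen.preimage (continuous_const_mul g⁻¹)
    refine Filter.eventually_of_mem (hVg.mem_nhds (by simp [h1V])) fun g' hg' ↦ ?_
    obtain ⟨hwN, hcw⟩ := hVN _ hg'
    -- decompose `g = γs^k n`
    obtain ⟨k, -, n, hn, u, hu, hg, he⟩ := ext_spec D g
    rw [Subgroup.mem_bot] at hu
    rw [hu, mul_one] at hg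
    have e : g' = γs ^ k * (n * (g⁻¹ * g')) * 1 := by rw [mul_one, ← mul_assoc, ← hg, mul_inv_cancel_left]
    rw [he, ext_eq hc hUM hUc D g' (N.mul_mem hn hwN) (Subgroup.one_mem _) e]
    unfold extVal
    rw [hc _ hn _ hwN, hcw, smul_zero, add_zero]
  -- the class
  let Φ : contOneCocycles (discreteTopRep H M) := ⟨⟨ext D, hcontext⟩, fun g h ↦ ext_mul hc hUM hUc hstar' D g h⟩
  refine ⟨oneCocycleClass _ Φ, ?_⟩
  rw [resOfLe_oneCocycleClass]
  congr 1
  apply Subtype.ext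
  ext n
  rw [contOneCocycles.pullback_apply]
  change ext D (subgroupInclusion hle n) = φ.1 n
  have hnN : subgroupInclusion hle n ∈ N := by
    rw [Subgroup.mem_subgroupOf]; exact n.2
  rw [ext_of_mem hc hUM hUc D hnN, hcN _ n.2]
  exact congrArg (fun z ↦ φ.1 z) (Subtype.ext rfl)

/-- **Surjectivity onto the invariants when `Ĥ⁰(⟨γ⟩, M^{H′}) = 0`.** In the setting of `exists_resOfLe_eq_of_witness`, suppose every
`H′`-fixed, `γ`-fixed `a ∈ M` is a NORM: `a = Σ_{i<t} γⁱ·b` with `b` `H′`-fixed. Then every `γ`-invariant class `x ∈ H¹(H′, M)` is a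
restriction from `H¹(H, M)` (adjust the witness `m` by the `b` of the obstruction; §1 shows the obstruction qualifies).
[cite: SerreGaloisCohomology1997, I.§2.6 (b)] [cite: NeukirchSchmidtWingberg2008, I.§6 Prop. 1.6.7] -/
theorem exists_resOfLe_eq_of_conjH1_eq_of_norm [H'.Normal] (hle : H' ≤ H) {γ : G} (hγ : γ ∈ H) {t : ℕ} (ht : 0 < t)
    (hγt : γ ^ t ∈ H') (hdvd : ∀ d : ℕ, γ ^ d ∈ H' → t ∣ d) (hcover : ∀ g ∈ H, ∃ k < t, ∃ n ∈ H', g = γ ^ k * n)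
    (hopen : IsOpen ((H'.subgroupOf H : Subgroup H) : Set H))
    (hH0 : ∀ a : M, (∀ n ∈ H', n • a = a) → γ • a = a → ∃ b : M, (∀ n ∈ H', n • b = b) ∧ a = ∑ i ∈ Finset.range t, γ ^ i • b)
    (x : subgroupH1 H' M) (hx : conjH1 H' M γ x = x) :
    ∃ y : subgroupH1 H M, resOfLe M hle y = x := by
  obtain ⟨φ, rfl⟩ := oneCocycleClass_surjective (discreteTopRep H' M) x
  obtain ⟨m, hstar⟩ := exists_witness_of_conjH1_eq γ φ hx
  obtain ⟨b, hbN, hob⟩ := hH0 _ (fun n hn ↦ smul_obstruction_eq hγt φ m hstar ⟨n, hn⟩) (smul_obstruction_eq' hγt φ m hstar)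
  refine exists_resOfLe_eq_of_witness hle hγ ht hγt hdvd hcover hopen φ (m + b) (fun n ↦ ?_) ?_
  · rw [hstar n, smul_add, hbN _ n.2]; abel
  · rw [sum_range_smul_add, ← hob, add_sub_cancel]

end Summit.BirchSwinnertonDyer.BirchSwinnertonDyer.Theorems.PrintCf2.CyclicInfRes

end
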